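import Mathlib
import HarnessLib
import Summits.HubbardSuperconductivity.HubbardSuperconductivity.Theorems.KLProgrammeKLRegimeVolumeLimitPerSiteDoors
import Summits.HubbardSuperconductivity.HubbardSuperconductivity.Theorems.KLProgrammeKLRegimeSplitBundleV16
import Summits.HubbardSuperconductivity.HubbardSuperconductivity.Theses.KLProgramme

/-!
# Gen-6 VL child `KLRegimeVolumeLimitV16` (stmt-HubbardSuperconductivity-20239, bundle `klPredsV16`): the ROUTE DECL from PER-SITE / PER-LABEL data —
# by-`--workitem` closers for the engine lineage (seat hubbard-kl-k3c5-p3 g7, VL co-registrant; technique «OS-positivity-free direct assembly»)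

Route `KLProgramme`, crux K3 `KLRegimeTwoPointLimit` (stmt-…-19937), gen-6 child `…Theses.KLProgramme.KLRegimeVolumeLimitV16 :=
VolumeLimitP2 klPredsV16 FinalTwoLegVolLimitEx klWindowC` (registered skeleton «cauchy v6» cd1a43ed7d9c9a49, ONE stub `stub_vl_nested`).  Companion of
…VolumeLimitV16NestedClosers (p514610: the five modulus-free nested exports).  Whatever the registered stub text, the item CLOSES (`--workitem stmt-…-20239`)
from ANY ONE of the following exports at `(klPredsV16, klWindowC)` — the per-site / per-label doors of …VolumeLimitPerSiteDoors instantiated through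
`klPredsV16_frameOK_imp`:

* `KLRegimeVolumeLimitV16_of_perLabelInfEpsText` — cutoff-free, per label, nested same-momentum, ε-form (no rate function, no cutoff bookkeeping);
* `KLRegimeVolumeLimitV16_of_perSiteEpsText` / `_of_perSiteText` — per site `z ∈ ℤ²` and per label `n`: nested ε-comparability / rates of the site-kernel
  values `torusFourierInv (Σ∞⁰_L(n,·)) (Torus.proj L z)`;
* **`KLRegimeVolumeLimitV16_of_perSiteLimitText`** — per site and label: the number `h_L(n,z)` CONVERGES as `L → ∞` (BGM 2006 Lemma 2.4 verbatim);
* `KLRegimeVolumeLimitV16_of_perSiteCutoffLimitText` — the same for the finite-cutoff site kernel, iterated `lim_L lim_M` (the engine's own variables);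
* `KLRegimeVolumeLimitV16_of_perSiteTermwiseText` — per site and label: a termwise expansion with an `L`-uniform summable majorant and termwise limits.

One complex sequence at a time: no norm, no uniformity in `n`, `z`, momentum or cutoff, no modulus, no rate, no periodisation.  Everything is proved;
no definition; nothing is asserted about the model.
-/

noncomputable section

namespace Summit.HubbardSuperconductivity.HubbardSuperconductivity.Theorems.TwoPointAssembly

set_option linter.dupNamespace false -- summit = problem name (single-conjunct summit), D-0017

open Finset Filter Topology Literature.MathematicalPhysics.QuantumLattice Literature.Probability.LatticeModels
open Literature.MathematicalPhysics.QuantumLattice.FermiRG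
open Summit.HubbardSuperconductivity.HubbardSuperconductivity.Theorems.DispersionFlow
open Summit.HubbardSuperconductivity.HubbardSuperconductivity.Theorems.KLRegimeSplit
open Summit.HubbardSuperconductivity.HubbardSuperconductivity.Theorems.KLProgrammeLegKernels

/-- **The gen-6 VL child from the CUTOFF-FREE per-label momentum export in ε-form (nested, same momentum, one Matsubara integer at a time, thresholds `L₁(n,ε)`).** -/
theorem KLRegimeVolumeLimitV16_of_perLabelInfEpsText
    (h : ∀ (G : GeoConsts) (P : SplitConsts) (Q : EngConsts) (R : RenConsts), G.WF → P.WF → Q.WF → R.WF →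
      ∃ c₅ : ℝ, 0 < c₅ ∧ ∀ c : ℝ, 0 < c → c ≤ c₅ → ∃ U₀ : ℝ, 0 < U₀ ∧
        ∀ μ ∈ klWindowC, ∀ U : ℝ, 0 < U → U ≤ U₀ → ∀ β : ℝ, klBetaMin ≤ β → β ≤ Real.exp (c / U ^ 2) →
          ∀ K : TrigPolyC4v, klPredsV16.frameOK R U (nScales β) μ K →
            ∀ (Lstar : ℕ) (Mstar : ℕ → ℕ), TowerP klPredsV16 G P Q R β U μ K Lstar Mstar →
              ∀ (n : ℤ), ∀ ε > (0 : ℝ), ∃ L₁ : ℕ, ∀ (L : ℕ) [NeZero L], L₁ ≤ L → ∀ (L'' : ℕ) [NeZero L''], L ∣ L'' →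
                ∀ (k : TorusSite 2 L) (k'' : TorusSite 2 L''), latticeMomentum L'' k'' = latticeMomentum L k →
                  ‖klSelfEnergyInf L β U μ 0 n k - klSelfEnergyInf L'' β U μ 0 n k''‖ ≤ ε) :
    Summit.HubbardSuperconductivity.HubbardSuperconductivity.Theses.KLProgramme.KLRegimeVolumeLimitV16 :=
  volumeLimitP2_of_perLabelInfEpsText klPredsV16 klWindowC klPredsV16_frameOK_imp h

/-- **The gen-6 VL child from PER-SITE nested ε-comparability of the cutoff-free carrier's site kernel (one label `n`, one lattice offset `z` at a time).** -/
theorem KLRegimeVolumeLimitV16_of_perSiteEpsText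
    (h : ∀ (G : GeoConsts) (P : SplitConsts) (Q : EngConsts) (R : RenConsts), G.WF → P.WF → Q.WF → R.WF →
      ∃ c₅ : ℝ, 0 < c₅ ∧ ∀ c : ℝ, 0 < c → c ≤ c₅ → ∃ U₀ : ℝ, 0 < U₀ ∧
        ∀ μ ∈ klWindowC, ∀ U : ℝ, 0 < U → U ≤ U₀ → ∀ β : ℝ, klBetaMin ≤ β → β ≤ Real.exp (c / U ^ 2) →
          ∀ K : TrigPolyC4v, klPredsV16.frameOK R U (nScales β) μ K →
            ∀ (Lstar : ℕ) (Mstar : ℕ → ℕ), TowerP klPredsV16 G P Q R β U μ K Lstar Mstar →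
              ∀ (n : ℤ) (z : Site 2), ∀ ε > (0 : ℝ), ∃ L₁ : ℕ, ∀ (L : ℕ) [NeZero L], L₁ ≤ L → ∀ (L'' : ℕ) [NeZero L''], L ∣ L'' →
                ‖torusFourierInv (fun p : TorusSite 2 L => klSelfEnergyInf L β U μ 0 n p) (Torus.proj L z) -
                    torusFourierInv (fun p : TorusSite 2 L'' => klSelfEnergyInf L'' β U μ 0 n p) (Torus.proj L'' z)‖ ≤ ε) :
    Summit.HubbardSuperconductivity.HubbardSuperconductivity.Theses.KLProgramme.KLRegimeVolumeLimitV16 :=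
  volumeLimitP2_of_perSiteEpsText klPredsV16 klWindowC klPredsV16_frameOK_imp h

/-- **The gen-6 VL child from PER-SITE nested RATES (site- and label-dependent thresholds and rates).** -/
theorem KLRegimeVolumeLimitV16_of_perSiteText
    (h : ∀ (G : GeoConsts) (P : SplitConsts) (Q : EngConsts) (R : RenConsts), G.WF → P.WF → Q.WF → R.WF →
      ∃ c₅ : ℝ, 0 < c₅ ∧ ∀ c : ℝ, 0 < c → c ≤ c₅ → ∃ U₀ : ℝ, 0 < U₀ ∧
        ∀ μ ∈ klWindowC, ∀ U : ℝ, 0 < U → U ≤ U₀ → ∀ β : ℝ, klBetaMin ≤ β → β ≤ Real.exp (c / U ^ 2) →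
          ∀ K : TrigPolyC4v, klPredsV16.frameOK R U (nScales β) μ K →
            ∀ (Lstar : ℕ) (Mstar : ℕ → ℕ), TowerP klPredsV16 G P Q R β U μ K Lstar Mstar →
              ∀ (n : ℤ) (z : Site 2), ∃ L₀ : ℕ, ∃ ρ : ℕ → ℝ, Tendsto ρ atTop (𝓝 0) ∧
                ∀ (L : ℕ) [NeZero L], L₀ ≤ L → ∀ (L'' : ℕ) [NeZero L''], L ∣ L'' →
                  ‖torusFourierInv (fun p : TorusSite 2 L => klSelfEnergyInf L β U μ 0 n p) (Torus.proj L z) -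
                      torusFourierInv (fun p : TorusSite 2 L'' => klSelfEnergyInf L'' β U μ 0 n p) (Torus.proj L'' z)‖ ≤ ρ L) :
    Summit.HubbardSuperconductivity.HubbardSuperconductivity.Theses.KLProgramme.KLRegimeVolumeLimitV16 :=
  volumeLimitP2_of_perSiteText klPredsV16 klWindowC klPredsV16_frameOK_imp h

/-- **The gen-6 VL child from PER-SITE PLAIN LIMITS (BGM 2006 Lemma 2.4 verbatim: for each `n` and `z` the number `h_L(n,z)` converges as `L → ∞`).** -/
theorem KLRegimeVolumeLimitV16_of_perSiteLimitText
    (h : ∀ (G : GeoConsts) (P : SplitConsts) (Q : EngConsts) (R : RenConsts), G.WF → P.WF → Q.WF → R.WF →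
      ∃ c₅ : ℝ, 0 < c₅ ∧ ∀ c : ℝ, 0 < c → c ≤ c₅ → ∃ U₀ : ℝ, 0 < U₀ ∧
        ∀ μ ∈ klWindowC, ∀ U : ℝ, 0 < U → U ≤ U₀ → ∀ β : ℝ, klBetaMin ≤ β → β ≤ Real.exp (c / U ^ 2) →
          ∀ K : TrigPolyC4v, klPredsV16.frameOK R U (nScales β) μ K →
            ∀ (Lstar : ℕ) (Mstar : ℕ → ℕ), TowerP klPredsV16 G P Q R β U μ K Lstar Mstar →
              ∀ (n : ℤ) (z : Site 2), ∃ hlim : ℂ, ∀ ε > (0 : ℝ), ∃ L₁ : ℕ, ∀ (L : ℕ) [NeZero L], L₁ ≤ L →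
                ‖torusFourierInv (fun p : TorusSite 2 L => klSelfEnergyInf L β U μ 0 n p) (Torus.proj L z) - hlim‖ ≤ ε) :
    Summit.HubbardSuperconductivity.HubbardSuperconductivity.Theses.KLProgramme.KLRegimeVolumeLimitV16 :=
  volumeLimitP2_of_perSiteLimitText klPredsV16 klWindowC klPredsV16_frameOK_imp h

/-- **The gen-6 VL child from PER-SITE ITERATED FINITE-CUTOFF LIMITS `lim_L lim_M` of the site kernel of `Σ̂⁰_{L,M}(ω,·)` at `matsubaraInt M ω = n` (the engine's own variables).** -/
theorem KLRegimeVolumeLimitV16_of_perSiteCutoffLimitText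
    (h : ∀ (G : GeoConsts) (P : SplitConsts) (Q : EngConsts) (R : RenConsts), G.WF → P.WF → Q.WF → R.WF →
      ∃ c₅ : ℝ, 0 < c₅ ∧ ∀ c : ℝ, 0 < c → c ≤ c₅ → ∃ U₀ : ℝ, 0 < U₀ ∧
        ∀ μ ∈ klWindowC, ∀ U : ℝ, 0 < U → U ≤ U₀ → ∀ β : ℝ, klBetaMin ≤ β → β ≤ Real.exp (c / U ^ 2) →
          ∀ K : TrigPolyC4v, klPredsV16.frameOK R U (nScales β) μ K →
            ∀ (Lstar : ℕ) (Mstar : ℕ → ℕ), TowerP klPredsV16 G P Q R β U μ K Lstar Mstar →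
              ∀ (n : ℤ) (z : Site 2), ∃ hlim : ℂ, ∀ ε > (0 : ℝ), ∃ L₁ : ℕ, ∀ (L : ℕ) [NeZero L], L₁ ≤ L →
                ∃ M₁ : ℕ, ∀ (M : ℕ) [NeZero M], M₁ ≤ M → ∀ ω : MatsubaraIdx M, matsubaraInt M ω = n →
                  ‖torusFourierInv (fun p : TorusSite 2 L => klSelfEnergy L M β U μ 0 klE0 (nScales β + 1) (ω, p) 0) (Torus.proj L z) - hlim‖ ≤ ε) :
    Summit.HubbardSuperconductivity.HubbardSuperconductivity.Theses.KLProgramme.KLRegimeVolumeLimitV16 :=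
  volumeLimitP2_of_perSiteCutoffLimitText klPredsV16 klWindowC klPredsV16_frameOK_imp h

/-- **The gen-6 VL child from PER-SITE TERMWISE expansions with an `L`-uniform summable majorant and termwise limits (Lemma 2.4's proof shape).** -/
theorem KLRegimeVolumeLimitV16_of_perSiteTermwiseText
    (h : ∀ (G : GeoConsts) (P : SplitConsts) (Q : EngConsts) (R : RenConsts), G.WF → P.WF → Q.WF → R.WF →
      ∃ c₅ : ℝ, 0 < c₅ ∧ ∀ c : ℝ, 0 < c → c ≤ c₅ → ∃ U₀ : ℝ, 0 < U₀ ∧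
        ∀ μ ∈ klWindowC, ∀ U : ℝ, 0 < U → U ≤ U₀ → ∀ β : ℝ, klBetaMin ≤ β → β ≤ Real.exp (c / U ^ 2) →
          ∀ K : TrigPolyC4v, klPredsV16.frameOK R U (nScales β) μ K →
            ∀ (Lstar : ℕ) (Mstar : ℕ → ℕ), TowerP klPredsV16 G P Q R β U μ K Lstar Mstar →
              ∀ (n : ℤ) (z : Site 2), ∃ (ι : Type) (a : ι → ℕ → ℂ) (alim : ι → ℂ) (m : ι → ℝ) (L₀ : ℕ),
                Summable m ∧ (∀ i, Tendsto (a i) atTop (𝓝 (alim i))) ∧ (∀ i L, L₀ ≤ L → ‖a i L‖ ≤ m i) ∧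
                  ∀ (L : ℕ) [NeZero L], L₀ ≤ L →
                    torusFourierInv (fun p : TorusSite 2 L => klSelfEnergyInf L β U μ 0 n p) (Torus.proj L z) = ∑' i, a i L) :
    Summit.HubbardSuperconductivity.HubbardSuperconductivity.Theses.KLProgramme.KLRegimeVolumeLimitV16 :=
  volumeLimitP2_of_perSiteTermwiseText klPredsV16 klWindowC klPredsV16_frameOK_imp h

end Summit.HubbardSuperconductivity.HubbardSuperconductivity.Theorems.TwoPointAssembly

end
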